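import Summits.QuantumAdvantage.QuantumAdvantage.Theorems.CubicStability.Negative.P4Facts
import Literature.Computability.QuantumComplexity.CubicForrelation

/-!
# `SignedCubicForrelationInPrBPP` — negative knowledge: the RESIDUE of the picked line is inhabited (by `P₄`)

Support file for crux `stmt-QuantumAdvantage-13933` (route `QuantumAdvantage/CubicForrelation`), written by the
standing disprover refuter-cdisprove-stmt-QuantumAdvantage-13933-0 (2026-08-16) for the PICKED line
`polar-radical-seeds` (`Cruxes/SignedCubicForrelationInPrBPP/Lines/polar_radical_seeds.lean`).

That line cuts the promise by STRUCTURE: an instance is on the "MM side" when one of its two functions has a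
HALF-DIMENSIONAL M-SUBSPACE (`V ∋ 0`, `⊕`-closed, `|V|² = 2ⁿ`, all second differences along `V` vanish — Dillon's
criterion), and everything else is the residue, whose membership in `PromiseBPP'` is the line's crux-sized
`stub_residue`. This file shows the residue is NOT EMPTY, so `stub_residue` is not vacuous and the safe partial
decider of `stub_safeMM` is complete only on a PROPER sub-promise: the landed CubicStability witness `P₄`
(`Theorems/CubicStability/Negative/P4Witness.lean`: `a = fA = ⊕_k [wt(x^k) = 2]`, `b = gB = ⊕_k x^k₁x^k₂x^k₃` on
`n = 12 = 4·3`, both cubic, `Φ(a,b) = 625/1024 ≥ 3/5`) has NO half-dimensional M-subspace on EITHER side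
(`gB_no_halfdim`, `fA_no_halfdim`, packaged as `residue_witness_P4`).

Proof (entirely finite + counting): the second difference of `gB` along `(u,v)` at `y` is the XOR over the four
blocks of the second differences of the cube `c3` along the block components (`gB_sd_blocks`); if it vanishes for
all `y` then each block term is constant in its block argument (`const_of_xor4`), and a second difference of the
cube `x₀x₁x₂` (or of `[wt = 2] = x₀x₁ ⊕ x₀x₂ ⊕ x₁x₂ ⊕ x₀x₁x₂`, same cubic part) along `(p,q)` is constant iff
`p, q` are linearly dependent (`c3_sd_const`, `s3_sd_const`, by `decide`). Hence in every block the projection of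
`V` has at most one non-zero element, so `V` injects into a product of four sets of size `≤ 2`: `|V| ≤ 16 < 64`.
By `⊕`-gluing exact pairs (Disproof.lean §2b `yes_glue_exact`) residue instances then exist at every even `n ≥ 12`
(the glued function's M-subspaces stay two dimensions short of half).

## References

* C. Carlet, Boolean Functions for Cryptography and Coding Theory, CUP 2021, Prop. 54 (Dillon's criterion for the
  completed Maiorana–McFarland class) — orientation for "M-subspace".
* Tree: `Theorems/CubicStability/Negative/P4Witness.lean`, `P4Facts.lean` (the witness, its cubicity and `Φ ≥ 3/5`).
-/

noncomputable section

set_option linter.dupNamespace false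

namespace Summit.QuantumAdvantage.QuantumAdvantage.Theorems.SignedCubicForrelationInPrBPP.Negative

open Finset
open Literature.Computability.QuantumComplexity
open Literature.Computability.QuantumComplexity.BuzetChailloux (bxor zeroVec)
open Summit.QuantumAdvantage.QuantumAdvantage.Theorems.CubicStability.Negative.P4

/-! ### Second differences of a block function -/

/-- The second difference of `c : 𝔽₂³ → 𝔽₂` along `(p, q)` at `w`. [folklore] -/
def sd (c : V → Bool) (p q w : V) : Bool :=
  c w ^^ c (bxor w p) ^^ c (bxor w q) ^^ c (bxor w (bxor p q))

/-- A second difference of the cube `x₀x₁x₂` along `(p,q)` is constant in `w` only if `p, q` are linearly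
dependent (`p = 0`, `q = 0` or `p = q`): its linear part is the cross product of `p` and `q`. [folklore] -/
theorem c3_sd_const : ∀ p q : V, (∀ w w' : V, sd c3 p q w = sd c3 p q w') →
    p = zero3 ∨ q = zero3 ∨ p = q := by
  decide

/-- The same for `[wt = 2] = x₀x₁ ⊕ x₀x₂ ⊕ x₁x₂ ⊕ x₀x₁x₂` (same cubic part; the second difference of the quadratic
part is constant). [folklore] -/
theorem s3_sd_const : ∀ p q : V, (∀ w w' : V, sd s3 p q w = sd s3 p q w') →
    p = zero3 ∨ q = zero3 ∨ p = q := by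
  decide

/-! ### Block calculus on `𝔽₂¹² = (𝔽₂³)⁴` -/

/-- Blocks commute with XOR. [folklore] -/
theorem blk_bxor (y u : Fin (4 * 3) → Bool) (k : Fin 4) : blk (bxor y u) k = bxor (blk y k) (blk u k) := rfl

/-- `blk` is injective (it is the equivalence `eBlk`). [folklore] -/
theorem blk_injective : Function.Injective (blk : (Fin (4 * 3) → Bool) → Fin 4 → V) :=
  fun _ _ h => eBlk.injective h

/-- The zero vector has zero blocks. [folklore] -/
theorem blk_zeroVec (k : Fin 4) : blk (zeroVec : Fin (4 * 3) → Bool) k = zero3 := rfl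

/-- `xor` is commutative (instance for `ac_rfl`). [folklore] -/
instance instCommutativeBoolXor : Std.Commutative (α := Bool) (· ^^ ·) := ⟨Bool.xor_comm⟩

/-- `xor` is associative (instance for `ac_rfl`). [folklore] -/
instance instAssociativeBoolXor : Std.Associative (α := Bool) (· ^^ ·) := ⟨Bool.xor_assoc⟩

/-- AC-regrouping of a 4 × 4 XOR. [folklore] -/
theorem xor16_regroup (a₀ a₁ a₂ a₃ b₀ b₁ b₂ b₃ c₀ c₁ c₂ c₃ d₀ d₁ d₂ d₃ : Bool) :
    ((a₀ ^^ a₁ ^^ a₂ ^^ a₃) ^^ (b₀ ^^ b₁ ^^ b₂ ^^ b₃) ^^ (c₀ ^^ c₁ ^^ c₂ ^^ c₃) ^^ (d₀ ^^ d₁ ^^ d₂ ^^ d₃)) =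
      ((a₀ ^^ b₀ ^^ c₀ ^^ d₀) ^^ (a₁ ^^ b₁ ^^ c₁ ^^ d₁) ^^ (a₂ ^^ b₂ ^^ c₂ ^^ d₂) ^^ (a₃ ^^ b₃ ^^ c₃ ^^ d₃)) := by
  ac_rfl

/-- The second difference of `gB = ⊕_k c3 (block k)` splits over the blocks. [folklore] -/
theorem gB_sd_blocks (y u v : Fin (4 * 3) → Bool) :
    (gB y ^^ gB (bxor y u) ^^ gB (bxor y v) ^^ gB (bxor y (bxor u v))) =
      (sd c3 (blk u 0) (blk v 0) (blk y 0) ^^ sd c3 (blk u 1) (blk v 1) (blk y 1) ^^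
        sd c3 (blk u 2) (blk v 2) (blk y 2) ^^ sd c3 (blk u 3) (blk v 3) (blk y 3)) := by
  simp only [gB, sd, blk_bxor]
  exact xor16_regroup _ _ _ _ _ _ _ _ _ _ _ _ _ _ _ _

/-- The second difference of `fA = ⊕_k s3 (block k)` splits over the blocks. [folklore] -/
theorem fA_sd_blocks (y u v : Fin (4 * 3) → Bool) :
    (fA y ^^ fA (bxor y u) ^^ fA (bxor y v) ^^ fA (bxor y (bxor u v))) =
      (sd s3 (blk u 0) (blk v 0) (blk y 0) ^^ sd s3 (blk u 1) (blk v 1) (blk y 1) ^^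
        sd s3 (blk u 2) (blk v 2) (blk y 2) ^^ sd s3 (blk u 3) (blk v 3) (blk y 3)) := by
  simp only [fA, sd, blk_bxor]
  exact xor16_regroup _ _ _ _ _ _ _ _ _ _ _ _ _ _ _ _

/-- If a XOR of four block terms vanishes for every block assignment, each term is constant. [folklore] -/
theorem const_of_xor4 (A B C D : V → Bool)
    (h : ∀ U : Fin 4 → V, (A (U 0) ^^ B (U 1) ^^ C (U 2) ^^ D (U 3)) = false) (w w' : V) :
    A w = A w' ∧ B w = B w' ∧ C w = C w' ∧ D w = D w' := by
  have hA1 := h ![w, zero3, zero3, zero3]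
  have hA2 := h ![w', zero3, zero3, zero3]
  have hB1 := h ![zero3, w, zero3, zero3]
  have hB2 := h ![zero3, w', zero3, zero3]
  have hC1 := h ![zero3, zero3, w, zero3]
  have hC2 := h ![zero3, zero3, w', zero3]
  have hD1 := h ![zero3, zero3, zero3, w]
  have hD2 := h ![zero3, zero3, zero3, w']
  simp only [Matrix.cons_val_zero, Matrix.cons_val_one, Matrix.cons_val] at hA1 hA2 hB1 hB2 hC1 hC2 hD1 hD2
  generalize A w = aw at hA1 ⊢; generalize A w' = aw' at hA2 ⊢
  generalize B w = bw at hB1 ⊢; generalize B w' = bw' at hB2 ⊢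
  generalize C w = cw at hC1 ⊢; generalize C w' = cw' at hC2 ⊢
  generalize D w = dw at hD1 ⊢; generalize D w' = dw' at hD2 ⊢
  generalize A zero3 = a0 at hB1 hB2 hC1 hC2 hD1 hD2
  generalize B zero3 = b0 at hA1 hA2 hC1 hC2 hD1 hD2
  generalize C zero3 = c0 at hA1 hA2 hB1 hB2 hD1 hD2
  generalize D zero3 = d0 at hA1 hA2 hB1 hB2 hC1 hC2
  revert aw aw' bw bw' cw cw' dw dw' a0 b0 c0 d0 hA1 hA2 hB1 hB2 hC1 hC2 hD1 hD2
  decide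

/-! ### Counting: a set of blocks with pairwise dependent members has at most two elements -/

/-- A finite set of `𝔽₂³`-vectors any two of which are dependent has at most two elements. [folklore] -/
theorem card_le_two_of_dep (P : Finset V) (h : ∀ a ∈ P, ∀ b ∈ P, a = zero3 ∨ b = zero3 ∨ a = b) :
    P.card ≤ 2 := by
  classical
  by_cases hex : ∃ a ∈ P, a ≠ zero3
  · obtain ⟨a, ha, ha0⟩ := hex
    have hsub : P ⊆ {zero3, a} := by
      intro b hb
      rcases h a ha b hb with h1 | h1 | h1
      · exact absurd h1 ha0
      · simp [h1]
      · simp [h1]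
    exact (card_le_card hsub).trans (card_insert_le _ _ |>.trans (by simp))
  · push Not at hex
    have hsub : P ⊆ {zero3} := fun b hb => by simp [hex b hb]
    exact (card_le_card hsub).trans (by simp)

/-! ### The two non-existence statements -/

/-- From vanishing second differences of a block-separable cubic along a `⊕`-closed `W`: the blockwise projections
of `W` consist of pairwise dependent vectors, hence `|W| ≤ 16`. [folklore] -/
theorem card_le_sixteen (c : V → Bool)
    (hc : ∀ p q : V, (∀ w w' : V, sd c p q w = sd c p q w') → p = zero3 ∨ q = zero3 ∨ p = q)
    (W : Finset (Fin (4 * 3) → Bool))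
    (hM : ∀ u ∈ W, ∀ v ∈ W, ∀ y : Fin (4 * 3) → Bool,
      (sd c (blk u 0) (blk v 0) (blk y 0) ^^ sd c (blk u 1) (blk v 1) (blk y 1) ^^
        sd c (blk u 2) (blk v 2) (blk y 2) ^^ sd c (blk u 3) (blk v 3) (blk y 3)) = false) :
    W.card ≤ 16 := by
  classical
  -- blockwise dependence
  have dep : ∀ u ∈ W, ∀ v ∈ W, ∀ k : Fin 4, blk u k = zero3 ∨ blk v k = zero3 ∨ blk u k = blk v k := by
    intro u hu v hv k
    have hU : ∀ U : Fin 4 → V, (sd c (blk u 0) (blk v 0) (U 0) ^^ sd c (blk u 1) (blk v 1) (U 1) ^^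
        sd c (blk u 2) (blk v 2) (U 2) ^^ sd c (blk u 3) (blk v 3) (U 3)) = false := by
      intro U
      have := hM u hu v hv (eBlk.symm U)
      simpa only [blk_eBlk_symm] using this
    have key := fun w w' => const_of_xor4 (sd c (blk u 0) (blk v 0)) (sd c (blk u 1) (blk v 1))
      (sd c (blk u 2) (blk v 2)) (sd c (blk u 3) (blk v 3)) hU w w'
    fin_cases k
    · exact hc _ _ fun w w' => (key w w').1
    · exact hc _ _ fun w w' => (key w w').2.1
    · exact hc _ _ fun w w' => (key w w').2.2.1
    · exact hc _ _ fun w w' => (key w w').2.2.2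
  -- projections
  set P : Fin 4 → Finset V := fun k => W.image fun u => blk u k with hP
  have hPk : ∀ k, (P k).card ≤ 2 := by
    intro k
    refine card_le_two_of_dep _ fun a ha b hb => ?_
    obtain ⟨u, hu, rfl⟩ := mem_image.1 ha
    obtain ⟨v, hv, rfl⟩ := mem_image.1 hb
    exact dep u hu v hv k
  -- injection into the product of the projections
  have hmaps : ∀ u ∈ W, blk u ∈ Fintype.piFinset P := by
    intro u hu
    exact Fintype.mem_piFinset.2 fun k => mem_image_of_mem _ hu
  have hinj : Set.InjOn (blk : (Fin (4 * 3) → Bool) → Fin 4 → V) W :=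
    fun u _ u' _ h => blk_injective h
  calc W.card ≤ (Fintype.piFinset P).card := card_le_card_of_injOn _ hmaps hinj
    _ = ∏ k, (P k).card := Fintype.card_piFinset _
    _ ≤ ∏ _k : Fin 4, 2 := prod_le_prod' fun k _ => hPk k
    _ = 16 := by norm_num

/-- **`gB` has no half-dimensional M-subspace**: no `⊕`-closed `V ∋ 0` with `|V|² = 2¹²` carries all second
differences of `gB` to zero (the hypotheses `0 ∈ V`, `⊕`-closed are not even needed). [folklore] -/
theorem gB_no_halfdim : ¬ ∃ W : Finset (Fin (4 * 3) → Bool), zeroVec ∈ W ∧ (∀ x ∈ W, ∀ y ∈ W, bxor x y ∈ W) ∧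
    ((W.card : ℝ)) ^ 2 = (2 : ℝ) ^ (4 * 3) ∧
    ∀ u ∈ W, ∀ v ∈ W, ∀ y, (gB y ^^ gB (bxor y u) ^^ gB (bxor y v) ^^ gB (bxor y (bxor u v))) = false := by
  rintro ⟨W, -, -, hcard, hM⟩
  have h16 : W.card ≤ 16 :=
    card_le_sixteen c3 c3_sd_const W fun u hu v hv y => by rw [← gB_sd_blocks]; exact hM u hu v hv y
  have h16' : (W.card : ℝ) ≤ 16 := by exact_mod_cast h16
  have hsq : (W.card : ℝ) ^ 2 ≤ 16 ^ 2 := by gcongr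
  rw [hcard] at hsq
  norm_num at hsq

/-- **`fA` has no half-dimensional M-subspace** either. [folklore] -/
theorem fA_no_halfdim : ¬ ∃ W : Finset (Fin (4 * 3) → Bool), zeroVec ∈ W ∧ (∀ x ∈ W, ∀ y ∈ W, bxor x y ∈ W) ∧
    ((W.card : ℝ)) ^ 2 = (2 : ℝ) ^ (4 * 3) ∧
    ∀ u ∈ W, ∀ v ∈ W, ∀ y, (fA y ^^ fA (bxor y u) ^^ fA (bxor y v) ^^ fA (bxor y (bxor u v))) = false := by
  rintro ⟨W, -, -, hcard, hM⟩
  have h16 : W.card ≤ 16 :=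
    card_le_sixteen s3 s3_sd_const W fun u hu v hv y => by rw [← fA_sd_blocks]; exact hM u hu v hv y
  have h16' : (W.card : ℝ) ≤ 16 := by exact_mod_cast h16
  have hsq : (W.card : ℝ) ^ 2 ≤ 16 ^ 2 := by gcongr
  rw [hcard] at hsq
  norm_num at hsq

/-- **The residue of line `polar-radical-seeds` is inhabited at the function level.** On `n = 12` (even) the cubic
pair `(fA, gB)` is in the promise (`Φ ≥ 3/5`, landed `yes_fA_gB`) while NEITHER function has a half-dimensional
M-subspace — the hypothesis of the line's MM side fails on both sides. [folklore] -/
theorem residue_witness_P4 :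
    Even (4 * 3) ∧ IsDegLeFun 3 fA ∧ IsDegLeFun 3 gB ∧ (3 : ℝ) / 5 ≤ forrelation fA gB ∧
    (¬ ∃ W : Finset (Fin (4 * 3) → Bool), zeroVec ∈ W ∧ (∀ x ∈ W, ∀ y ∈ W, bxor x y ∈ W) ∧
      ((W.card : ℝ)) ^ 2 = (2 : ℝ) ^ (4 * 3) ∧
      ∀ u ∈ W, ∀ v ∈ W, ∀ y, (fA y ^^ fA (bxor y u) ^^ fA (bxor y v) ^^ fA (bxor y (bxor u v))) = false) ∧
    (¬ ∃ W : Finset (Fin (4 * 3) → Bool), zeroVec ∈ W ∧ (∀ x ∈ W, ∀ y ∈ W, bxor x y ∈ W) ∧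
      ((W.card : ℝ)) ^ 2 = (2 : ℝ) ^ (4 * 3) ∧
      ∀ u ∈ W, ∀ v ∈ W, ∀ y, (gB y ^^ gB (bxor y u) ^^ gB (bxor y v) ^^ gB (bxor y (bxor u v))) = false) :=
  ⟨⟨6, rfl⟩, isCubic_fA, isCubic_gB, yes_fA_gB, fA_no_halfdim, gB_no_halfdim⟩

end Summit.QuantumAdvantage.QuantumAdvantage.Theorems.SignedCubicForrelationInPrBPP.Negative

end
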